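import Summits.ABC.ABC.Theorems.DefiniteXiPolyFreyDegreeValuation
import Literature.NumberTheory.DiophantineGeometry.ConductorRadicalProofs
import Literature.NumberTheory.DiophantineGeometry.AbcValuationProduct
import HarnessLib

/-!
# Crux `XiStrongBound` (stmt-ABC-11337), line SplitProof — stub 4: the Frey allowance from the
# abc valuation-product milestone

stub 4 of line SplitProof for crux XiStrongBound (stmt-ABC-11337): the abc valuation-product
milestone gives the Frey allowance T = ∏_{q∣N} v_q(Δ_min) ≤ C_ε N^ε.

Precisely (`stub_allTamExp_of_valuationProduct`; the original name `stub_allTamExp_of_abcValuationProduct`,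
p87956, is kept as a deprecated alias): the OPEN milestone `AbcValuationProduct`
(stmt-ABC-1567 of route ABC/RibetTakahashiSplit: `∏_{p ∣ abc} v_p(abc) ≤ K_ε rad(abc)^ε` for abc
triples; dropped from that route's item list by the 2026-08-16 items-cap autofix, so the former
route decl `Summit.ABC.ABC.Theses.RibetTakahashiSplit.AbcValuationProduct` is inlined here
verbatim), taken as a HYPOTHESIS, implies that for
coprime integers `a, b` with `ab(a+b) ≠ 0` and `N` the conductor of the Frey curve `E_{a,b}`,
`T := ∏_{q ∈ N.primeFactors} v_q(Δ_min(E_{a,b})) ≤ C_ε N^ε` (all bad primes, `2` included).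

Proof (elementary given the tree): with `n = |ab(a+b)|`,
* `v_q(Δ_min(E_{a,b})) ≤ v_q(Δ(W₀)) = v_q(16 n²) ≤ 4 + 2 v_q(n) ≤ 6 · max(1, v_q(n))` at EVERY
  prime `q`, where `W₀` is the integral model (12.17) of Bombieri–Gubler Ex. 12.5.10: the order of
  the minimal discriminant is at most the order of the discriminant of any integral model
  (Silverman AEC VII.1, definition of minimality; here `valuation_Δ_le_of_isIntegralAt`,
  `factorization_minimalDiscriminantNorm_le_of_int`);
* hence `T ≤ 6^{ω(N)} · ∏_{q ∈ N.primeFactors} max(1, v_q(n)) ≤ 6^{ω(N)} · ∏_{p ∣ n} v_p(n)`;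
* `6^{ω(N)} ≤ 8^{ω(N)} = (2^{ω(N)})³ ≤ C₁³ rad(N)^{ε/2} ≤ C₁³ N^{ε/2}`
  (`exists_two_pow_card_primeFactors_le` at `δ = ε/6`);
* signs rearranged, `(|a|, |b|, |a+b|)` is an abc triple with product `n`
  (`exists_isABCTriple_of_isCoprime`), so the milestone at `ε/2` gives
  `∏_{p ∣ n} v_p(n) ≤ K rad(n)^{ε/2}`, and `rad(n) ∣ 2N`
  (`radical_natAbs_dvd_two_mul_conductorNorm_freyCurve`);
* so `T ≤ C₁³ · max(K,0) · 2^{ε/2} · N^ε`.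
No new definitions.
-/

-- `Summit.<Summit>.<Problem>` is the mandated summit-side namespace (CONVENTIONS §2); for the single-conjunct summit `ABC` the two coincide, so the duplicate `ABC.ABC` is deliberate.
set_option linter.dupNamespace false

namespace Summit.ABC.ABC.Theorems

open Literature.NumberTheory.EllipticCurves Literature.NumberTheory.Automorphic
open Literature.NumberTheory.DiophantineGeometry
open IsDedekindDomain UniqueFactorizationMonoid

/-! ### The minimal discriminant divides the discriminant of every integral model, prime by prime -/

/-- **Minimality, read against an integral model.** For an elliptic Weierstrass equation `W / K`
that is `v`-integral, `v (Δ W) ≤ exp (-ord_v Δ_min)` in the value group `ℤᵐ⁰`, i.e.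
`ord_v (Δ_min) ≤ ord_v (Δ W)`: the chosen local minimal model is `M = C • W_v` (Mathlib's
`WeierstrassCurve.minimal`), it is minimal, and `W_v = C⁻¹ • M` is integral, so
`v (Δ W_v) ≤ v (Δ M) = exp (-ord_v Δ_min)` (Silverman, AEC VII.1, definition of a minimal
equation; the bridge `addVal ↔ Valued.v` is
`IsDedekindDomain.HeightOneSpectrum.exists_addVal_adicCompletionIntegers_eq`). [folklore] -/
theorem valuation_Δ_le_of_isIntegralAt
    {A : Type*} [CommRing A] [IsDedekindDomain A] {K : Type*} [Field K] [Algebra A K]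
    [IsFractionRing A K] (v : HeightOneSpectrum A) (W : WeierstrassCurve K) [W.IsElliptic]
    (hW : W.IsIntegralAt v) :
    v.valuation K W.Δ ≤ WithZero.exp (-(W.ordMinimalDiscriminant v : ℤ)) := by
  set Ov := v.adicCompletionIntegers K
  set Kv := v.adicCompletion K
  set Wv := W.baseChange Kv with hWv
  set C := (Wv.exists_isMinimal Ov).choose
  have hM : W.localMinimalModel v = C • Wv := rfl
  have hmin : (C • Wv).IsMinimal Ov := (Wv.exists_isMinimal Ov).choose_spec
  rw [WeierstrassCurve.isMinimal_iff_of_le_one_iff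
    (WeierstrassCurve.valued_le_one_iff_mem_range_adicCompletionIntegers v)] at hmin
  -- `W_v = C⁻¹ • (C • W_v)` is integral, so minimality of `C • W_v` bounds `v (Δ W_v)`
  have hint : (C⁻¹ • C • Wv).IsIntegral Ov := by rw [inv_smul_smul]; exact hW
  have key := hmin.2 C⁻¹ hint
  rw [inv_smul_smul] at key
  have hWΔ : Wv.Δ = algebraMap K Kv W.Δ := by
    rw [hWv, WeierstrassCurve.baseChange, WeierstrassCurve.map_Δ]
  rw [hWΔ, WeierstrassCurve.valued_algebraMap_adicCompletion] at key
  -- `v (Δ (C • W_v)) = exp (-ord_v Δ_min)` through the integral model and the `addVal` bridge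
  have hMΔ : algebraMap Ov Kv (W.localMinimalIntegralModel v).Δ = (C • Wv).Δ := by
    rw [← hM]; exact WeierstrassCurve.integralModel_Δ_eq Ov _
  set r := (W.localMinimalIntegralModel v).Δ with hr
  have hΔ0 : v.valuation K W.Δ ≠ 0 := by
    rw [Valuation.ne_zero_iff]; exact W.isUnit_Δ.ne_zero
  have hr0 : r ≠ 0 := by
    intro h0
    rw [h0, map_zero] at hMΔ
    rw [← hMΔ, map_zero] at key
    exact hΔ0 (le_antisymm key zero_le)
  obtain ⟨n, hn, hvn⟩ := HeightOneSpectrum.exists_addVal_adicCompletionIntegers_eq K v r hr0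
  have hord : W.ordMinimalDiscriminant v = n := by
    rw [WeierstrassCurve.ordMinimalDiscriminant, ← hr, hn]; rfl
  rw [← hMΔ] at key
  have hrK : algebraMap Ov Kv r = (r : Kv) := rfl
  rw [hrK, hvn] at key
  rw [hord]
  exact key

/-- For an integral Weierstrass equation `W₀` over `ℤ` with `W₀ ⊗ ℚ` elliptic and every prime `p`:
`v_p(|Δ_min|) ≤ v_p(Δ(W₀))` — `ord_p (Δ_min) ≤ ord_p (Δ (W₀))` (`valuation_Δ_le_of_isIntegralAt`,
`W₀ ⊗ ℚ` being integral at every place), with `v_p(|Δ_min|) = ord_p (Δ_min)`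
(`WeierstrassCurve.factorization_minimalDiscriminantNorm_holds`) and the dictionary
`v (n) ≤ exp (-k) ↔ p ^ k ∣ n`. Silverman, AEC VII.1 and VIII.8. [folklore] -/
theorem factorization_minimalDiscriminantNorm_le_of_int (W₀ : WeierstrassCurve ℤ)
    [(W₀.baseChange ℚ).IsElliptic] {p : ℕ} (hp : p.Prime) :
    ((W₀.baseChange ℚ).minimalDiscriminantNorm ℤ).factorization p ≤
      W₀.Δ.natAbs.factorization p := by
  obtain ⟨v, hv⟩ := exists_place ⟨p, hp⟩
  have hvp : Rat.HeightOneSpectrum.natGenerator v = p := hv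
  have hfac := WeierstrassCurve.factorization_minimalDiscriminantNorm_holds (W₀.baseChange ℚ) v
  rw [hvp] at hfac
  rw [hfac]
  have hle := valuation_Δ_le_of_isIntegralAt v (W₀.baseChange ℚ)
    (WeierstrassCurve.isIntegralAt_baseChange_int v W₀)
  rw [WeierstrassCurve.baseChange_int_Δ] at hle
  have hdvd :=
    (Literature.NumberTheory.EllipticCurves.Rat.valuation_intCast_le_exp_iff v _ _).mp hle
  rw [hvp] at hdvd
  have hΔ0 : W₀.Δ ≠ 0 := WeierstrassCurve.Δ_ne_zero_of_isElliptic_baseChange_int W₀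
  have hdvd' : p ^ (W₀.baseChange ℚ).ordMinimalDiscriminant v ∣ W₀.Δ.natAbs := by
    have h := Int.natAbs_dvd_natAbs.mpr hdvd
    rwa [Int.natAbs_pow, Int.natAbs_natCast] at h
  exact (hp.pow_dvd_iff_le_factorization (Int.natAbs_ne_zero.mpr hΔ0)).mp hdvd'

/-- **Frey exponents at every prime, `2` included.** For `ab(a+b) ≠ 0` and every prime `q`,
`v_q(Δ_min(E_{a,b})) ≤ 4 + 2 v_q(ab(a+b))`: the integral model (12.17) of Bombieri–Gubler
Ex. 12.5.10 has `Δ = 16 (ab(a+b))²` (`freyIntModel_Δ`) and `v_q(16) ≤ 4`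
(`factorization_minimalDiscriminantNorm_le_of_int`). [folklore] -/
theorem factorization_minimalDiscriminantNorm_freyCurve_le_add {a b : ℤ}
    (h0 : a * b * (a + b) ≠ 0) {q : ℕ} (hq : q.Prime) :
    ((freyCurve a b).minimalDiscriminantNorm ℤ).factorization q ≤
      4 + 2 * (a * b * (a + b)).natAbs.factorization q := by
  rw [← baseChange_freyIntModel]
  haveI := isElliptic_freyIntModel h0
  refine (factorization_minimalDiscriminantNorm_le_of_int (freyIntModel a b) hq).trans ?_
  have hm0 : (a * b * (a + b)).natAbs ≠ 0 := Int.natAbs_ne_zero.mpr h0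
  rw [freyIntModel_Δ, Int.natAbs_mul, Int.natAbs_pow,
    Nat.factorization_mul (by norm_num) (pow_ne_zero 2 hm0), Nat.factorization_pow,
    Finsupp.add_apply, Finsupp.smul_apply, smul_eq_mul]
  refine Nat.add_le_add_right ?_ _
  rw [show (16 : ℤ).natAbs = 2 ^ 4 by rfl, Nat.factorization_pow, Finsupp.smul_apply, smul_eq_mul,
    Nat.prime_two.factorization, Finsupp.single_apply]
  split_ifs <;> omega

/-! ### Signs rearranged into an abc triple -/

/-- For coprime integers `a, b` with `ab(a+b) ≠ 0`, two of `|a|, |b|, |a+b|` add up to the third,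
so a permutation of them is an abc triple, with product `|ab(a+b)|` (as in `abc_int_of_abcLe`).
[folklore] -/
theorem exists_isABCTriple_of_isCoprime {a b : ℤ} (hab : IsCoprime a b)
    (h0 : a * b * (a + b) ≠ 0) :
    ∃ x y z : ℕ, IsABCTriple x y z ∧ x * y * z = (a * b * (a + b)).natAbs := by
  have hA : a ≠ 0 := fun h ↦ h0 (by rw [h]; ring)
  have hB : b ≠ 0 := fun h ↦ h0 (by rw [h]; ring)
  have hD : a + b ≠ 0 := fun h ↦ h0 (by rw [h]; ring)
  set x := a.natAbs with hx
  set y := b.natAbs with hy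
  set z := (a + b).natAbs with hz
  have hx0 : 0 < x := Int.natAbs_pos.mpr hA
  have hy0 : 0 < y := Int.natAbs_pos.mpr hB
  have hz0 : 0 < z := Int.natAbs_pos.mpr hD
  have hprod : (a * b * (a + b)).natAbs = x * y * z := by simp [hx, hy, hz, Int.natAbs_mul]
  rw [hprod]
  have cop : ∀ {M N : ℤ}, IsCoprime M N → Nat.Coprime M.natAbs N.natAbs := by
    intro M N h
    rw [Nat.Coprime, ← Int.gcd_eq_natAbs]
    exact Int.isCoprime_iff_gcd_eq_one.mp h
  have hAD : IsCoprime a (a + b) := by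
    obtain ⟨u, w, huw⟩ := hab
    exact ⟨u - w, w, by linear_combination huw⟩
  have hBD : IsCoprime b (a + b) := by
    obtain ⟨u, w, huw⟩ := hab
    exact ⟨w - u, u, by linear_combination huw⟩
  have hcases : x + y = z ∨ x + z = y ∨ y + z = x := by omega
  rcases hcases with h | h | h
  · exact ⟨x, y, z, ⟨hx0, hy0, h, cop hab⟩, rfl⟩
  · exact ⟨x, z, y, ⟨hx0, hz0, h, cop hAD⟩, by ring⟩
  · exact ⟨y, z, x, ⟨hy0, hz0, h, cop hBD⟩, by ring⟩

/-! ### The stub -/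

/-- **Stub 4 of line SplitProof for the crux `XiStrongBound` — the Frey allowance from the abc
valuation-product milestone.** If `∏_{p ∣ abc} v_p(abc) ≤ K_ε rad(abc)^ε` for all abc triples
(the milestone `AbcValuationProduct`, stmt-ABC-1567 of route ABC/RibetTakahashiSplit — dropped from
that route's item list on 2026-08-16, so its statement is INLINED here verbatim as the hypothesis),
then for coprime
integers `a, b` with `ab(a+b) ≠ 0` and `N` the conductor of the Frey curve `E_{a,b}`:
`∏_{q ∈ N.primeFactors} v_q(Δ_min(E_{a,b})) ≤ C_ε N^ε`. Chain (`n = |ab(a+b)|`):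
`v_q(Δ_min) ≤ 4 + 2 v_q(n) ≤ 6 max(1, v_q(n))` at every prime, so
`T ≤ 6^{ω(N)} ∏_{p ∣ n} v_p(n)`; `6^{ω(N)} ≤ (2^{ω(N)})³ ≤ C₁³ N^{ε/2}`; signs rearranged,
`∏_{p ∣ n} v_p(n) ≤ K rad(n)^{ε/2} ≤ max(K,0) (2N)^{ε/2}` (`rad(n) ∣ 2N`). [folklore] -/
theorem stub_allTamExp_of_valuationProduct :
    (∀ ε : ℝ, 0 < ε → ∃ K : ℝ, ∀ a b c : ℕ,
      Literature.NumberTheory.DiophantineGeometry.IsABCTriple a b c →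
        ((∏ p ∈ (a * b * c).primeFactors, (a * b * c).factorization p : ℕ) : ℝ) ≤
          K * ((Literature.NumberTheory.DiophantineGeometry.rad a b c : ℕ) : ℝ) ^ ε) →
      ∀ ε : ℝ, 0 < ε → ∃ C : ℝ, ∀ a b : ℤ, IsCoprime a b → a * b * (a + b) ≠ 0 →
        ∀ (N : ℕ) [NeZero N], (freyCurve a b).conductorNorm ℤ = N →
          ((∏ q ∈ N.primeFactors, ((freyCurve a b).minimalDiscriminantNorm ℤ).factorization q : ℕ) : ℝ) ≤
            C * (N : ℝ) ^ ε := by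
  intro hAVP ε hε
  -- the milestone at `ε/2`; the squarefree-kernel bound `2^ω ≤ C₁ rad^δ` at `δ = ε/6`
  obtain ⟨K, hK⟩ := hAVP (ε / 2) (by positivity)
  obtain ⟨C₁, hC₁, hω⟩ := exists_two_pow_card_primeFactors_le (ε / 6) (by positivity)
  refine ⟨C₁ ^ 3 * max K 0 * (2 : ℝ) ^ (ε / 2), fun a b hab h0 N _ hN => ?_⟩
  set n : ℕ := (a * b * (a + b)).natAbs with hn
  have hn0 : n ≠ 0 := Int.natAbs_ne_zero.mpr h0
  set D : ℕ := (freyCurve a b).minimalDiscriminantNorm ℤ with hD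
  have hNpos : 0 < N := Nat.pos_of_ne_zero (NeZero.ne N)
  have hNreal : (0 : ℝ) < (N : ℝ) := by exact_mod_cast hNpos
  -- (1) per-prime bound `v_q(Δ_min) ≤ 6 max(1, v_q(n))`
  have hq : ∀ q ∈ N.primeFactors, D.factorization q ≤ 6 * max 1 (n.factorization q) := by
    intro q hqN
    have h1 := factorization_minimalDiscriminantNorm_freyCurve_le_add h0
      (Nat.prime_of_mem_primeFactors hqN)
    have h2 : 1 ≤ max 1 (n.factorization q) := le_max_left _ _
    have h3 : n.factorization q ≤ max 1 (n.factorization q) := le_max_right _ _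
    rw [← hD, ← hn] at h1
    omega
  -- (2) the product bound in `ℕ`: `T ≤ 6^ω(N) · ∏_{p ∣ n} v_p(n)`
  have hT : ∏ q ∈ N.primeFactors, D.factorization q ≤
      6 ^ N.primeFactors.card * ∏ p ∈ n.primeFactors, n.factorization p := by
    have h1 : ∏ q ∈ N.primeFactors, D.factorization q ≤
        ∏ q ∈ N.primeFactors, 6 * max 1 (n.factorization q) :=
      Finset.prod_le_prod (fun _ _ => Nat.zero_le _) hq
    have h2 : ∏ q ∈ N.primeFactors, max 1 (n.factorization q) ≤
        ∏ q ∈ N.primeFactors ∪ n.primeFactors, max 1 (n.factorization q) :=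
      Finset.prod_le_prod_of_subset_of_one_le' Finset.subset_union_left
        fun _ _ _ => le_max_left _ _
    have h3 : ∏ q ∈ n.primeFactors, max 1 (n.factorization q) =
        ∏ q ∈ N.primeFactors ∪ n.primeFactors, max 1 (n.factorization q) := by
      refine Finset.prod_subset Finset.subset_union_right fun q _ hqn => ?_
      have h : n.factorization q = 0 :=
        Finsupp.notMem_support_iff.mp (by rwa [Nat.support_factorization])
      rw [h, max_eq_left (Nat.zero_le 1)]
    have h4 : ∏ q ∈ n.primeFactors, max 1 (n.factorization q) =
        ∏ q ∈ n.primeFactors, n.factorization q :=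
      Finset.prod_congr rfl fun q hqn => max_eq_right
        (Nat.Prime.factorization_pos_of_dvd (Nat.prime_of_mem_primeFactors hqn) hn0
          (Nat.dvd_of_mem_primeFactors hqn))
    calc ∏ q ∈ N.primeFactors, D.factorization q
        ≤ ∏ q ∈ N.primeFactors, 6 * max 1 (n.factorization q) := h1
      _ = 6 ^ N.primeFactors.card * ∏ q ∈ N.primeFactors, max 1 (n.factorization q) := by
          rw [Finset.prod_mul_distrib, Finset.prod_const]
      _ ≤ 6 ^ N.primeFactors.card * ∏ q ∈ n.primeFactors, n.factorization q := by
          rw [← h4, h3]; exact Nat.mul_le_mul_left _ h2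
  -- (3) `6^ω(N) ≤ (2^ω(N))³ ≤ (C₁ rad(N)^{ε/6})³ ≤ C₁³ N^{ε/2}`
  have hradN : (∏ p ∈ N.primeFactors, (p : ℝ)) ≤ (N : ℝ) := by
    have h := Nat.le_of_dvd hNpos (Nat.prod_primeFactors_dvd N)
    rw [← Nat.cast_prod]
    exact_mod_cast h
  have h2ω : (2 : ℝ) ^ N.primeFactors.card ≤ C₁ * (N : ℝ) ^ (ε / 6) :=
    (hω N).trans (mul_le_mul_of_nonneg_left
      (Real.rpow_le_rpow (by positivity) hradN (by positivity)) hC₁.le)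
  have h6ω : (6 : ℝ) ^ N.primeFactors.card ≤ C₁ ^ 3 * (N : ℝ) ^ (ε / 2) := by
    calc (6 : ℝ) ^ N.primeFactors.card ≤ (2 ^ 3) ^ N.primeFactors.card :=
          pow_le_pow_left₀ (by norm_num) (by norm_num) _
      _ = ((2 : ℝ) ^ N.primeFactors.card) ^ 3 := by rw [← pow_mul, mul_comm, pow_mul]
      _ ≤ (C₁ * (N : ℝ) ^ (ε / 6)) ^ 3 := pow_le_pow_left₀ (by positivity) h2ω 3
      _ = C₁ ^ 3 * ((N : ℝ) ^ (ε / 6)) ^ (3 : ℕ) := mul_pow _ _ _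
      _ = C₁ ^ 3 * (N : ℝ) ^ (ε / 2) := by
          congr 1
          rw [← Real.rpow_natCast ((N : ℝ) ^ (ε / 6)) 3, ← Real.rpow_mul hNreal.le]
          congr 1
          push_cast
          ring
  -- (4) the milestone on the rearranged triple: `∏_{p ∣ n} v_p(n) ≤ max(K,0) (2N)^{ε/2}`
  obtain ⟨x, y, z, hxyz, hprod⟩ := exists_isABCTriple_of_isCoprime hab h0
  have hK' := hK x y z hxyz
  rw [rad_def, hprod, ← hn] at hK'
  have hradn : ((radical n : ℕ) : ℝ) ≤ 2 * (N : ℝ) := by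
    have hdvd := radical_natAbs_dvd_two_mul_conductorNorm_freyCurve hab h0
    rw [hN, ← hn] at hdvd
    exact_mod_cast Nat.le_of_dvd (by positivity) hdvd
  have hP : ((∏ p ∈ n.primeFactors, n.factorization p : ℕ) : ℝ) ≤
      max K 0 * ((2 : ℝ) ^ (ε / 2) * (N : ℝ) ^ (ε / 2)) := by
    calc ((∏ p ∈ n.primeFactors, n.factorization p : ℕ) : ℝ)
        ≤ K * ((radical n : ℕ) : ℝ) ^ (ε / 2) := hK'
      _ ≤ max K 0 * ((radical n : ℕ) : ℝ) ^ (ε / 2) :=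
          mul_le_mul_of_nonneg_right (le_max_left _ _) (by positivity)
      _ ≤ max K 0 * (2 * (N : ℝ)) ^ (ε / 2) :=
          mul_le_mul_of_nonneg_left (Real.rpow_le_rpow (by positivity) hradn (by positivity))
            (le_max_right _ _)
      _ = max K 0 * ((2 : ℝ) ^ (ε / 2) * (N : ℝ) ^ (ε / 2)) := by
          rw [Real.mul_rpow (by norm_num) hNreal.le]
  -- (5) assemble
  have hTreal : ((∏ q ∈ N.primeFactors, D.factorization q : ℕ) : ℝ) ≤
      (6 : ℝ) ^ N.primeFactors.card * ((∏ p ∈ n.primeFactors, n.factorization p : ℕ) : ℝ) := by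
    exact_mod_cast hT
  calc ((∏ q ∈ N.primeFactors, D.factorization q : ℕ) : ℝ)
      ≤ (6 : ℝ) ^ N.primeFactors.card * ((∏ p ∈ n.primeFactors, n.factorization p : ℕ) : ℝ) :=
        hTreal
    _ ≤ (C₁ ^ 3 * (N : ℝ) ^ (ε / 2)) * (max K 0 * ((2 : ℝ) ^ (ε / 2) * (N : ℝ) ^ (ε / 2))) :=
        mul_le_mul h6ω hP (by positivity) (by positivity)
    _ = C₁ ^ 3 * max K 0 * (2 : ℝ) ^ (ε / 2) * ((N : ℝ) ^ (ε / 2) * (N : ℝ) ^ (ε / 2)) := by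
        ring
    _ = C₁ ^ 3 * max K 0 * (2 : ℝ) ^ (ε / 2) * (N : ℝ) ^ ε := by
        rw [← Real.rpow_add hNreal, add_halves]

/-- Deprecated spelling of `stub_allTamExp_of_valuationProduct`: the original statement took the route
decl `Summit.ABC.ABC.Theses.RibetTakahashiSplit.AbcValuationProduct` (stmt-ABC-1567) as hypothesis; that
decl was dropped from the gate-generated thesis module on 2026-08-16, so the hypothesis is now spelled out
(definitionally the same statement). [folklore] -/
@[deprecated stub_allTamExp_of_valuationProduct (since := "2026-08-16")]
alias stub_allTamExp_of_abcValuationProduct := stub_allTamExp_of_valuationProduct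

end Summit.ABC.ABC.Theorems
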